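/-
Copyright (c) 2026 the pub-hodgecm-mathlib formalisation cell (harness21).  Prover seat hodgecm-mathlib-LH3-p02 (g3): letter-L1 (I₂) pay-down, E3 brick (e3-5) «FRAME BRIDGE»
(LH3-plan (g3) LETTER-L1 (I₂) BOARD 2026-09-02T09:28:54Z by name; spec owner F0P3b-p01 (g16), census `CENSUS-I2-corners.v1.md` §3.4 (e3-5)).
-/
import Literature.NumberTheory.Automorphic.ArchInnerFormSemiregularCentralizerBlockCayley   -- ★ p850544 §1 Tools: `conj_monomialGL_boostStd_eq_gprimeSplitGL`; brings ★ atlas (`boostStd`, `boostEig`, `cayB`, `formRe`, `formSign`, `lineOf`, `splitChartPlaces`, `gprimeBlock`), ★ `ArchLocalRelabelTransport`, ★ `UnitaryGroupFormTransport`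
import Literature.NumberTheory.Automorphic.UnitaryGroupBorelInduction                         -- ★ `torusU`, `mem_torusU_iff`, `glDiagonal`
import HarnessLib

/-!
# Standardising the local factor at a split-chart place: a FIXED isomorphism `U(σ_w diag α)(ℂ) ≃ₜ* U(J₃)(ℂ)`, `J₃ = antidiag(1,1,1)`, carrying the split place chart (the boost)
# to the diagonal split Cartan `diag(e^{x+iθ}, e^{iφ}, e^{−x+iθ})` ON THE NOSE
# (Platonov–Rapinchuk 1994 §2.3; Rogawski 1990 §1.9 p. 8, §3.6 p. 31; Knapp 1986 V §3)

Topic `NumberTheory/Automorphic`; namespace `Literature.NumberTheory.Automorphic.UnitaryGroup`.  THEOREMS ONLY (no `def`, no instance, no notation, no axiom, no named fact, no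
`sorry`).  Cell `pub/hodgecm-mathlib`, crux H413 = `stmt-HodgeConjecture-24833`, F0∕P3c line LH3 (closer stub `stub_N9`), LETTER L1 `HcOrbitalFamiliesStatement` pay-down, clause (I₂),
ENGINE E3 «Harish-Chandra's parabolic unfolding on `U(2,1)_w`» (F0P3b-p01 (g16)'s census `CENSUS-I2-corners.v1.md` §3), brick **(e3-5) FRAME BRIDGE** (LH3-plan (g3) by name
2026-09-02T09:28:54Z): E3's identity ((e3-1)∕(e3-3)) is typed on the MODEL group `U(J₃)(ℂ)`, `hJ : J = (StdForm.antidiagonal 3).over ℂ`, with the DIAGONAL split Cartan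
`torusU` (`t = diag d`, `glDiagonal 3 ℂ d = ↑t`), whereas the letter's orbital family `orbFamG` lives on `G′_∞ = U(diag α)(L⁺ ⊗ ℝ)` whose local factor at a split-chart place `w`
is `archLocal L 3 (diagonal α) w = U(σ_w diag α)(ℂ)` with the split place chart = the BOOST `gprimeSplitGL (lineOf s_w) (formRe α w) (c w)` (★ `ArchInnerFormCartanAtlas`).
This file supplies ONE fixed topological-group isomorphism per split-chart place, `φ : U(σ_w diag α)(ℂ) ≃ₜ* U(J₃)(ℂ)`, `φ h = Q · (M(τ)⁻¹ h M(τ)) · Q⁻¹` with `τ = lineOf s_w`,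
`M(τ)` the permutation matrix (★ `ArchLocalRelabelTransport`) and the «Cayley-scale» matrix **`Q = N_b = (1, 0, r; 0, s, 0; 1, 0, −r)`**, `r = √(−b₂∕b₀)` (★ `cayB`'s token),
`s = √(2b₁∕b₀)`, `b = formRe α w ∘ τ`: since `N_b · cayB b = diag(2r, s, 2r)` is DIAGONAL, ★ `boostStd_mul_cayB` gives **`φ (boost at c) = diag(boostEig c) = diag(e^{x+iθ}, e^{iφ},
e^{−x+iθ})`** on the nose, and `N_bᴴ · J₃ · N_b = (2∕b₀) • diag b` makes `φ` an isomorphism onto `U(J₃)` (`U(c • H) = U(H)`).  Rank-3 twin of ★ (B-STD) `ArchRankOneBlockStandardise`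
(p850476, `P·D` for `U(1,1)`); the ball-model bridge ★ `ArchLocalDiagonalFrameU21` (target `U(diag(1,1,−1))`, COMPACT torus) is the other frame and is not touched.
* §1 standard position over a real diagonal form `diag b` (`b₀b₂ < 0 < b₀b₁`): `boostEig_ne_zero`, `boostEig_zero_ne_two∕one_of_ne` (regularity `x ≠ 0` in (e3-3)'s currency
  `(d 0)⁻¹ d 2 ≠ 1`, `(d 0)⁻¹ d 1 ≠ 1`), `boostStdGL_mem_unitaryGroupOfForm_diagonal`, `det_splitStdFrame_ne_zero`, `splitStdFrame_mul_boostStd` (`N_b · B(b;c) = diag(boostEig c) · N_b`),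
  `conjTranspose_splitStdFrame_mul_antidiagonal_mul` (`N_bᴴ J₃ N_b = (2∕b₀) • diag b`), `unitaryGroupOfForm_smul_eq` (`U(c • H) = U(H)`);
* §2 **`exists_continuousMulEquiv_diagonal_three_std`** — `∃ φ : U(diag b) ≃ₜ* U(J₃)`: torus clause (matrix form AND `glDiagonal` form ∈ `torusU`) + value clause;
* §3 **`exists_continuousMulEquiv_archLocal_splitChart_std`** — at a split-chart place of the house frame: `φ (gprimeBlock α w S′ c) = diag (boostEig (c w))` for `w ∈ S′`, value clause.
HONEST LABEL: HC_CM is proved only modulo the 7 printed citations (2 remaining: hLiu418 = `stmt-HodgeConjecture-24832`, h413 = `stmt-HodgeConjecture-24833`) until rung 0 closes;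
letter-L1 pay-down bookkeeping, count-neutral, pays nothing by itself.

## References
* [PlatonovRapinchuk1994] V. Platonov, A. Rapinchuk, *Algebraic Groups and Number Theory* (1994), §2.3 (unitary groups of congruent hermitian forms).
* [Rogawski1990] J. D. Rogawski, *Automorphic Representations of Unitary Groups in Three Variables*, Ann. of Math. Stud. 123 (1990), §1.9 p. 8 (`U(Φ₃)`, `M = {d(a, β, ā⁻¹)}`), §3.6 p. 31.
* [Knapp1986] A. W. Knapp, *Representation Theory of Semisimple Groups* (1986), Ch. V §3 (the boost of `SU(2,1)` and its eigenvectors).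
-/

set_option autoImplicit false

noncomputable section

open NumberField NumberField.InfinitePlace Matrix Complex Equiv
open Literature.LinearAlgebra.Matrix
open scoped MatrixGroups Matrix ComplexConjugate Real

namespace Literature.NumberTheory.Automorphic.UnitaryGroup

/-! ## §1 Standard position: the eigen-triple, the boost as a unitary element, the Cayley-scale frame `N_b` -/

section Standard

/-- No eigenvalue of the boost vanishes. [cite: Knapp1986, Ch. V §3] -/
theorem boostEig_ne_zero (c : Fin 3 → ℝ) (i : Fin 3) : boostEig c i ≠ 0 := by
  fin_cases i <;> exact Complex.exp_ne_zero _

/-- `‖boostEig c 0‖ = eˣ`, `‖boostEig c 1‖ = 1`, `‖boostEig c 2‖ = e⁻ˣ`. [cite: Knapp1986, Ch. V §3] -/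
theorem norm_boostEig (c : Fin 3 → ℝ) :
    ‖boostEig c 0‖ = Real.exp (c 0) ∧ ‖boostEig c 1‖ = 1 ∧ ‖boostEig c 2‖ = Real.exp (-(c 0)) := by
  refine ⟨?_, ?_, ?_⟩
  · show ‖Complex.exp ((c 0 : ℂ) + (c 2 : ℂ) * I)‖ = Real.exp (c 0)
    rw [Complex.norm_exp]; simp
  · show ‖Complex.exp ((c 1 : ℂ) * I)‖ = 1
    rw [Complex.norm_exp]; simp
  · show ‖Complex.exp (-(c 0 : ℂ) + (c 2 : ℂ) * I)‖ = Real.exp (-(c 0))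
    rw [Complex.norm_exp]; simp

/-- **Regularity off the real wall, first pair**: `e^{x+iθ} ≠ e^{−x+iθ}` when `x ≠ 0` ((e3-3)'s `(d 0)⁻¹ · d 2 ≠ 1`). [cite: Rogawski1990, §3.6 p. 31] -/
theorem boostEig_zero_ne_two_of_ne {c : Fin 3 → ℝ} (hx : c 0 ≠ 0) : boostEig c 0 ≠ boostEig c 2 := by
  intro h
  have h' := congrArg (fun z : ℂ => ‖z‖) h
  simp only [(norm_boostEig c).1, (norm_boostEig c).2.2] at h'
  have : c 0 = -(c 0) := Real.exp_injective h'
  exact hx (by linarith)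

/-- **Regularity off the real wall, second pair**: `e^{x+iθ} ≠ e^{iφ}` when `x ≠ 0` ((e3-3)'s `(d 0)⁻¹ · d 1 ≠ 1`). [cite: Rogawski1990, §3.6 p. 31] -/
theorem boostEig_zero_ne_one_of_ne {c : Fin 3 → ℝ} (hx : c 0 ≠ 0) : boostEig c 0 ≠ boostEig c 1 := by
  intro h
  have h' := congrArg (fun z : ℂ => ‖z‖) h
  simp only [(norm_boostEig c).1, (norm_boostEig c).2.1] at h'
  exact hx (by simpa using h')

/-- `(d 0)⁻¹ · d 2 ≠ 1` and `(d 0)⁻¹ · d 1 ≠ 1` for the unit triple `d = boostEig c` off the wall `x ≠ 0` — (e3-3)'s regularity binders VERBATIM. [cite: Rogawski1990, §3.6 p. 31] -/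
theorem boostEigUnits_regular_of_ne {c : Fin 3 → ℝ} (hx : c 0 ≠ 0) :
    ((((Units.mk0 (boostEig c 0) (boostEig_ne_zero c 0))⁻¹ * Units.mk0 (boostEig c 1) (boostEig_ne_zero c 1) : ℂˣ) : ℂ) ≠ 1) ∧
      ((((Units.mk0 (boostEig c 0) (boostEig_ne_zero c 0))⁻¹ * Units.mk0 (boostEig c 2) (boostEig_ne_zero c 2) : ℂˣ) : ℂ) ≠ 1) := by
  refine ⟨fun h => boostEig_zero_ne_one_of_ne hx ?_, fun h => boostEig_zero_ne_two_of_ne hx ?_⟩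
  · have h' : (boostEig c 0)⁻¹ * boostEig c 1 = 1 := by simpa using h
    rw [inv_mul_eq_one₀ (boostEig_ne_zero c 0)] at h'
    exact h'
  · have h' : (boostEig c 0)⁻¹ * boostEig c 2 = 1 := by simpa using h
    rw [inv_mul_eq_one₀ (boostEig_ne_zero c 0)] at h'
    exact h'

variable (b : Fin 3 → ℝ)

/-- **The boost is a unitary element of `U(diag b)(ℂ)`** (`b₀ b₂ < 0`; ★ `conjTranspose_boostStd_mul_diagonal_mul`). [cite: Knapp1986, Ch. V §3] [cite: Rogawski1990, §1.9 p. 8] -/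
theorem boostStdGL_mem_unitaryGroupOfForm_diagonal (hb : b 0 * b 2 < 0) (c : Fin 3 → ℝ) :
    Matrix.GeneralLinearGroup.mkOfDetNeZero (boostStd b c) (det_boostStd_ne_zero b c) ∈ unitaryGroupOfForm (starRingEnd ℂ) (Matrix.diagonal fun i => (b i : ℂ)) := by
  rw [mem_unitaryGroupOfForm_iff, Matrix.GeneralLinearGroup.val_mkOfDetNeZero, transpose_map_starRingEnd_complex]
  exact conjTranspose_boostStd_mul_diagonal_mul hb c

/-- `s = √(2b₁∕b₀) ≠ 0` when `b₀ b₁ > 0`. [cite: PlatonovRapinchuk1994, §2.3] -/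
theorem sqrt_two_mul_div_ne_zero (hb : 0 < b 0 * b 1) : Real.sqrt (2 * b 1 / b 0) ≠ 0 := by
  have hq : 0 < 2 * b 1 / b 0 := by
    rcases pos_and_pos_or_neg_and_neg_of_mul_pos hb with ⟨h0, h1⟩ | ⟨h0, h1⟩
    · exact div_pos (by linarith) h0
    · exact div_pos_of_neg_of_neg (by linarith) h0
  exact (Real.sqrt_pos.2 hq).ne'

/-- `0 ≤ 2b₁∕b₀` when `b₀ b₁ > 0`. [cite: PlatonovRapinchuk1994, §2.3] -/
theorem two_mul_div_nonneg (hb : 0 < b 0 * b 1) : 0 ≤ 2 * b 1 / b 0 := by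
  rcases pos_and_pos_or_neg_and_neg_of_mul_pos hb with ⟨h0, h1⟩ | ⟨h0, h1⟩
  · exact le_of_lt (div_pos (by linarith) h0)
  · exact le_of_lt (div_pos_of_neg_of_neg (by linarith) h0)

/-- `0 ≤ −b₂∕b₀` when `b₀ b₂ < 0`. [cite: Knapp1986, Ch. V §3] -/
theorem neg_div_nonneg_of_mul_neg (hb : b 0 * b 2 < 0) : 0 ≤ -b 2 / b 0 := by
  rcases mul_neg_iff.1 hb with ⟨h0, h2⟩ | ⟨h0, h2⟩
  · exact le_of_lt (div_pos (by linarith) h0)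
  · exact le_of_lt (div_pos_of_neg_of_neg (by linarith) h0)

/-- **`det N_b = −2·r·s ≠ 0`** for the Cayley-scale frame `N_b = (1, 0, r; 0, s, 0; 1, 0, −r)`. [cite: PlatonovRapinchuk1994, §2.3] -/
theorem det_splitStdFrame_ne_zero (hb02 : b 0 * b 2 < 0) (hb01 : 0 < b 0 * b 1) :
    (!![(1 : ℂ), 0, (Real.sqrt (-b 2 / b 0) : ℂ); 0, (Real.sqrt (2 * b 1 / b 0) : ℂ), 0; 1, 0, -(Real.sqrt (-b 2 / b 0) : ℂ)]).det ≠ 0 := by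
  have hr : (Real.sqrt (-b 2 / b 0) : ℂ) ≠ 0 := Complex.ofReal_ne_zero.2 (sqrt_ratio_ne_zero hb02)
  have hs : (Real.sqrt (2 * b 1 / b 0) : ℂ) ≠ 0 := Complex.ofReal_ne_zero.2 (sqrt_two_mul_div_ne_zero b hb01)
  have h : (!![(1 : ℂ), 0, (Real.sqrt (-b 2 / b 0) : ℂ); 0, (Real.sqrt (2 * b 1 / b 0) : ℂ), 0; 1, 0, -(Real.sqrt (-b 2 / b 0) : ℂ)]).det =
      -2 * ((Real.sqrt (-b 2 / b 0) : ℂ) * (Real.sqrt (2 * b 1 / b 0) : ℂ)) := by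
    rw [Matrix.det_fin_three]
    simp
    ring
  rw [h]
  exact mul_ne_zero (by norm_num) (mul_ne_zero hr hs)

/-- **`N_b · cayB b = diag(2r, s, 2r)`** — the Cayley-scale frame times the eigenvector matrix ★ `cayB` is DIAGONAL. [cite: Knapp1986, Ch. V §3] -/
theorem splitStdFrame_mul_cayB :
    !![(1 : ℂ), 0, (Real.sqrt (-b 2 / b 0) : ℂ); 0, (Real.sqrt (2 * b 1 / b 0) : ℂ), 0; 1, 0, -(Real.sqrt (-b 2 / b 0) : ℂ)] * cayB b =
      Matrix.diagonal ![2 * (Real.sqrt (-b 2 / b 0) : ℂ), (Real.sqrt (2 * b 1 / b 0) : ℂ), 2 * (Real.sqrt (-b 2 / b 0) : ℂ)] := by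
  ext i j
  fin_cases i <;> fin_cases j <;> simp [cayB, Matrix.mul_apply, Fin.sum_univ_three, Matrix.diagonal] <;> ring1

/-- **`N_b · B(b; c) = diag(boostEig c) · N_b`** — the Cayley-scale frame diagonalises every boost (★ `boostStd_mul_cayB`: `B · cayB = cayB · diag(boostEig c)`, and `N_b · cayB`
is diagonal, so commutes with `diag(boostEig c)`). [cite: Knapp1986, Ch. V §3] [cite: PlatonovRapinchuk1994, §2.3] -/
theorem splitStdFrame_mul_boostStd (hb02 : b 0 * b 2 < 0) (c : Fin 3 → ℝ) :
    !![(1 : ℂ), 0, (Real.sqrt (-b 2 / b 0) : ℂ); 0, (Real.sqrt (2 * b 1 / b 0) : ℂ), 0; 1, 0, -(Real.sqrt (-b 2 / b 0) : ℂ)] * boostStd b c =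
      Matrix.diagonal (boostEig c) * !![(1 : ℂ), 0, (Real.sqrt (-b 2 / b 0) : ℂ); 0, (Real.sqrt (2 * b 1 / b 0) : ℂ), 0; 1, 0, -(Real.sqrt (-b 2 / b 0) : ℂ)] := by
  have hu : IsUnit (cayB b).det := (det_cayB_ne_zero hb02).isUnit
  have hNC := splitStdFrame_mul_cayB b
  have hcomm : Matrix.diagonal ![2 * (Real.sqrt (-b 2 / b 0) : ℂ), (Real.sqrt (2 * b 1 / b 0) : ℂ), 2 * (Real.sqrt (-b 2 / b 0) : ℂ)] * Matrix.diagonal (boostEig c) =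
      Matrix.diagonal (boostEig c) * Matrix.diagonal ![2 * (Real.sqrt (-b 2 / b 0) : ℂ), (Real.sqrt (2 * b 1 / b 0) : ℂ), 2 * (Real.sqrt (-b 2 / b 0) : ℂ)] := by
    rw [Matrix.diagonal_mul_diagonal, Matrix.diagonal_mul_diagonal]
    congr 1
    funext i
    exact mul_comm _ _
  have key : !![(1 : ℂ), 0, (Real.sqrt (-b 2 / b 0) : ℂ); 0, (Real.sqrt (2 * b 1 / b 0) : ℂ), 0; 1, 0, -(Real.sqrt (-b 2 / b 0) : ℂ)] * boostStd b c * cayB b =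
      Matrix.diagonal (boostEig c) * !![(1 : ℂ), 0, (Real.sqrt (-b 2 / b 0) : ℂ); 0, (Real.sqrt (2 * b 1 / b 0) : ℂ), 0; 1, 0, -(Real.sqrt (-b 2 / b 0) : ℂ)] * cayB b := by
    rw [Matrix.mul_assoc, boostStd_mul_cayB hb02, ← Matrix.mul_assoc, hNC, hcomm, Matrix.mul_assoc, hNC]
  rw [← Matrix.mul_nonsing_inv_cancel_right (A := cayB b) (!![(1 : ℂ), 0, (Real.sqrt (-b 2 / b 0) : ℂ); 0, (Real.sqrt (2 * b 1 / b 0) : ℂ), 0; 1, 0, -(Real.sqrt (-b 2 / b 0) : ℂ)] * boostStd b c) hu,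
    key, Matrix.mul_nonsing_inv_cancel_right (A := cayB b) _ hu]

/-- **`N_bᴴ · J₃ · N_b = (2∕b₀) • diag b`** (`J₃ = antidiag(1,1,1)`; `r² = −b₂∕b₀`, `s² = 2b₁∕b₀`; `N_b` is real). [cite: PlatonovRapinchuk1994, §2.3] [cite: Rogawski1990, §1.9 p. 8] -/
theorem conjTranspose_splitStdFrame_mul_antidiagonal_mul (hb02 : b 0 * b 2 < 0) (hb01 : 0 < b 0 * b 1) :
    ((!![(1 : ℂ), 0, (Real.sqrt (-b 2 / b 0) : ℂ); 0, (Real.sqrt (2 * b 1 / b 0) : ℂ), 0; 1, 0, -(Real.sqrt (-b 2 / b 0) : ℂ)]).map (starRingEnd ℂ))ᵀ *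
        !![(0 : ℂ), 0, 1; 0, 1, 0; 1, 0, 0] *
        !![(1 : ℂ), 0, (Real.sqrt (-b 2 / b 0) : ℂ); 0, (Real.sqrt (2 * b 1 / b 0) : ℂ), 0; 1, 0, -(Real.sqrt (-b 2 / b 0) : ℂ)] =
      ((2 / b 0 : ℝ) : ℂ) • Matrix.diagonal fun i => (b i : ℂ) := by
  have hb0 : b 0 ≠ 0 := fun h => by rw [h, zero_mul] at hb02; exact lt_irrefl _ hb02
  have hb0' : (b 0 : ℂ) ≠ 0 := Complex.ofReal_ne_zero.2 hb0
  have hr2 : (Real.sqrt (-b 2 / b 0) : ℂ) * (Real.sqrt (-b 2 / b 0) : ℂ) = ((-b 2 / b 0 : ℝ) : ℂ) := by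
    rw [← Complex.ofReal_mul, Real.mul_self_sqrt (neg_div_nonneg_of_mul_neg b hb02)]
  have hs2 : (Real.sqrt (2 * b 1 / b 0) : ℂ) * (Real.sqrt (2 * b 1 / b 0) : ℂ) = ((2 * b 1 / b 0 : ℝ) : ℂ) := by
    rw [← Complex.ofReal_mul, Real.mul_self_sqrt (two_mul_div_nonneg b hb01)]
  have hconj : (!![(1 : ℂ), 0, (Real.sqrt (-b 2 / b 0) : ℂ); 0, (Real.sqrt (2 * b 1 / b 0) : ℂ), 0; 1, 0, -(Real.sqrt (-b 2 / b 0) : ℂ)]).map (starRingEnd ℂ) =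
      !![(1 : ℂ), 0, (Real.sqrt (-b 2 / b 0) : ℂ); 0, (Real.sqrt (2 * b 1 / b 0) : ℂ), 0; 1, 0, -(Real.sqrt (-b 2 / b 0) : ℂ)] := by
    ext i j
    fin_cases i <;> fin_cases j <;> simp [Complex.conj_ofReal]
  rw [hconj]
  ext i j
  fin_cases i <;> fin_cases j <;>
    simp [Matrix.mul_apply, Fin.sum_univ_three, Matrix.diagonal, Matrix.transpose_apply]
  all_goals first
    | (rw [hs2]; push_cast; field_simp)
    | (rw [hr2]; push_cast; field_simp; ring1)
    | (field_simp; ring1)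

/-- **`U(c • H) = U(H)`** for a non-zero scalar `c` (as subgroups of `GL_n`). [cite: PlatonovRapinchuk1994, §2.3] -/
theorem unitaryGroupOfForm_smul_eq {n : Type*} [Fintype n] [DecidableEq n] (H : Matrix n n ℂ) {c : ℂ} (hc : c ≠ 0) :
    unitaryGroupOfForm (starRingEnd ℂ) (c • H) = unitaryGroupOfForm (starRingEnd ℂ) H := by
  ext g
  rw [mem_unitaryGroupOfForm_iff, mem_unitaryGroupOfForm_iff, Matrix.mul_smul, Matrix.smul_mul]
  exact (smul_right_injective _ hc).eq_iff

/-! ## §2 The standardising isomorphism in standard position -/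

/-- `2 ∕ b₀ ≠ 0` (as a complex scalar) when `b₀ b₂ < 0`. [cite: PlatonovRapinchuk1994, §2.3] -/
theorem two_div_ne_zero_of_mul_neg (hb02 : b 0 * b 2 < 0) : ((2 / b 0 : ℝ) : ℂ) ≠ 0 := by
  have hb0 : b 0 ≠ 0 := fun h => by rw [h, zero_mul] at hb02; exact lt_irrefl _ hb02
  exact Complex.ofReal_ne_zero.2 (div_ne_zero two_ne_zero hb0)

/-- **The congruence**: `formCongr (N_b) J₃ = (2∕b₀) • diag b`. [cite: PlatonovRapinchuk1994, §2.3] [cite: Rogawski1990, §1.9 p. 8] -/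
theorem formCongr_splitStdFrame (hb02 : b 0 * b 2 < 0) (hb01 : 0 < b 0 * b 1) {J : Matrix (Fin 3) (Fin 3) ℂ} (hJ : J = (StdForm.antidiagonal 3).over ℂ) :
    formCongr (starRingEnd ℂ)
        (Matrix.GeneralLinearGroup.mkOfDetNeZero
          !![(1 : ℂ), 0, (Real.sqrt (-b 2 / b 0) : ℂ); 0, (Real.sqrt (2 * b 1 / b 0) : ℂ), 0; 1, 0, -(Real.sqrt (-b 2 / b 0) : ℂ)] (det_splitStdFrame_ne_zero b hb02 hb01)) J =
      ((2 / b 0 : ℝ) : ℂ) • Matrix.diagonal fun i => (b i : ℂ) := by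
  have hJ3 : J = !![(0 : ℂ), 0, 1; 0, 1, 0; 1, 0, 0] := by
    rw [hJ]
    ext i j
    fin_cases i <;> fin_cases j <;> simp [StdForm.over, StdForm.antidiagonal, Fin.rev]
  rw [hJ3, formCongr, Matrix.GeneralLinearGroup.val_mkOfDetNeZero]
  exact conjTranspose_splitStdFrame_mul_antidiagonal_mul b hb02 hb01

/-- **(e3-5) STANDARD POSITION — STANDARDISING `U(diag b)(ℂ)` ONTO `U(J₃)(ℂ)`.**  For a real diagonal form `diag b` with `b₀ b₂ < 0 < b₀ b₁` (signs `(+,+,−)` or `(−,−,+)` in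
slot order) there is ONE FIXED topological-group isomorphism `φ : U(diag b)(ℂ) ≃ₜ* U(J₃)(ℂ)`, `J₃ = antidiag(1,1,1)`, `φ h = N_b · h · N_b⁻¹` with the Cayley-scale frame
`N_b = (1, 0, r; 0, s, 0; 1, 0, −r)`, which carries every BOOST `B(b; c)` (★ `boostStd`, `c = (x, φ, θ)`) to the DIAGONAL split Cartan element `diag(boostEig c) =
diag(e^{x+iθ}, e^{iφ}, e^{−x+iθ}) ∈ torusU` ON THE NOSE — in the three currencies its consumers read: as a matrix, as `glDiagonal 3 ℂ d` with the explicit unit triple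
`d i = boostEig c i` ((e3-3)'s `hd`), and as membership in ★ `torusU` ((e3-3)'s `ht`); plus the value clause in the generic «conjugation by a fixed `T ∈ GL₃(ℂ)`» form.
[cite: PlatonovRapinchuk1994, §2.3] [cite: Rogawski1990, §1.9 p. 8; §3.6 p. 31] [cite: Knapp1986, Ch. V §3] -/
theorem exists_continuousMulEquiv_diagonal_three_std (hb02 : b 0 * b 2 < 0) (hb01 : 0 < b 0 * b 1) {J : Matrix (Fin 3) (Fin 3) ℂ} (hJ : J = (StdForm.antidiagonal 3).over ℂ) :
    ∃ φ : ↥(unitaryGroupOfForm (starRingEnd ℂ) (Matrix.diagonal fun i => (b i : ℂ))) ≃ₜ* ↥(unitaryGroupOfForm (starRingEnd ℂ) J),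
      (∀ c : Fin 3 → ℝ,
        (((φ ⟨Matrix.GeneralLinearGroup.mkOfDetNeZero (boostStd b c) (det_boostStd_ne_zero b c), boostStdGL_mem_unitaryGroupOfForm_diagonal b hb02 c⟩ :
            ↥(unitaryGroupOfForm (starRingEnd ℂ) J)) : GL (Fin 3) ℂ) : Matrix (Fin 3) (Fin 3) ℂ) = Matrix.diagonal (boostEig c)) ∧
      (∀ c : Fin 3 → ℝ,
        glDiagonal 3 ℂ (fun i => Units.mk0 (boostEig c i) (boostEig_ne_zero c i)) =
          ((φ ⟨Matrix.GeneralLinearGroup.mkOfDetNeZero (boostStd b c) (det_boostStd_ne_zero b c), boostStdGL_mem_unitaryGroupOfForm_diagonal b hb02 c⟩ :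
            ↥(unitaryGroupOfForm (starRingEnd ℂ) J)) : GL (Fin 3) ℂ)) ∧
      (∀ c : Fin 3 → ℝ,
        φ ⟨Matrix.GeneralLinearGroup.mkOfDetNeZero (boostStd b c) (det_boostStd_ne_zero b c), boostStdGL_mem_unitaryGroupOfForm_diagonal b hb02 c⟩ ∈
          torusU (starRingEnd ℂ) J) ∧
      (∀ h : ↥(unitaryGroupOfForm (starRingEnd ℂ) (Matrix.diagonal fun i => (b i : ℂ))),
        ((φ h : ↥(unitaryGroupOfForm (starRingEnd ℂ) J)) : GL (Fin 3) ℂ) =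
          Matrix.GeneralLinearGroup.mkOfDetNeZero
              !![(1 : ℂ), 0, (Real.sqrt (-b 2 / b 0) : ℂ); 0, (Real.sqrt (2 * b 1 / b 0) : ℂ), 0; 1, 0, -(Real.sqrt (-b 2 / b 0) : ℂ)] (det_splitStdFrame_ne_zero b hb02 hb01) *
            (h : GL (Fin 3) ℂ) *
          (Matrix.GeneralLinearGroup.mkOfDetNeZero
              !![(1 : ℂ), 0, (Real.sqrt (-b 2 / b 0) : ℂ); 0, (Real.sqrt (2 * b 1 / b 0) : ℂ), 0; 1, 0, -(Real.sqrt (-b 2 / b 0) : ℂ)] (det_splitStdFrame_ne_zero b hb02 hb01))⁻¹) ∧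
      (∃ T : GL (Fin 3) ℂ, ∀ h : ↥(unitaryGroupOfForm (starRingEnd ℂ) (Matrix.diagonal fun i => (b i : ℂ))),
        ((φ h : ↥(unitaryGroupOfForm (starRingEnd ℂ) J)) : GL (Fin 3) ℂ) = T * (h : GL (Fin 3) ℂ) * T⁻¹) := by
  have hcong := formCongr_splitStdFrame b hb02 hb01 hJ
  have hU : unitaryGroupOfForm (starRingEnd ℂ) (Matrix.diagonal fun i => (b i : ℂ)) =
      unitaryGroupOfForm (starRingEnd ℂ) (formCongr (starRingEnd ℂ)
        (Matrix.GeneralLinearGroup.mkOfDetNeZero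
          !![(1 : ℂ), 0, (Real.sqrt (-b 2 / b 0) : ℂ); 0, (Real.sqrt (2 * b 1 / b 0) : ℂ), 0; 1, 0, -(Real.sqrt (-b 2 / b 0) : ℂ)] (det_splitStdFrame_ne_zero b hb02 hb01)) J) := by
    rw [hcong, unitaryGroupOfForm_smul_eq _ (two_div_ne_zero_of_mul_neg b hb02)]
  -- the identity map between the two equal subgroups, as a topological-group isomorphism
  let ι : ↥(unitaryGroupOfForm (starRingEnd ℂ) (Matrix.diagonal fun i => (b i : ℂ))) ≃ₜ*
      ↥(unitaryGroupOfForm (starRingEnd ℂ) (formCongr (starRingEnd ℂ)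
        (Matrix.GeneralLinearGroup.mkOfDetNeZero
          !![(1 : ℂ), 0, (Real.sqrt (-b 2 / b 0) : ℂ); 0, (Real.sqrt (2 * b 1 / b 0) : ℂ), 0; 1, 0, -(Real.sqrt (-b 2 / b 0) : ℂ)] (det_splitStdFrame_ne_zero b hb02 hb01)) J)) :=
    { MulEquiv.subgroupCongr hU with
      continuous_toFun := continuous_induced_rng.2 continuous_subtype_val
      continuous_invFun := continuous_induced_rng.2 continuous_subtype_val }
  have hNu : IsUnit (!![(1 : ℂ), 0, (Real.sqrt (-b 2 / b 0) : ℂ); 0, (Real.sqrt (2 * b 1 / b 0) : ℂ), 0; 1, 0, -(Real.sqrt (-b 2 / b 0) : ℂ)]).det :=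
    (det_splitStdFrame_ne_zero b hb02 hb01).isUnit
  -- the matrix form of the torus clause
  have h1 : ∀ c : Fin 3 → ℝ,
      ((((ι.trans (unitaryGroupOfFormCongr (starRingEnd ℂ) _ J))
          ⟨Matrix.GeneralLinearGroup.mkOfDetNeZero (boostStd b c) (det_boostStd_ne_zero b c), boostStdGL_mem_unitaryGroupOfForm_diagonal b hb02 c⟩ :
            ↥(unitaryGroupOfForm (starRingEnd ℂ) J)) : GL (Fin 3) ℂ) : Matrix (Fin 3) (Fin 3) ℂ) = Matrix.diagonal (boostEig c) := by
    intro c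
    show ((Matrix.GeneralLinearGroup.mkOfDetNeZero
          !![(1 : ℂ), 0, (Real.sqrt (-b 2 / b 0) : ℂ); 0, (Real.sqrt (2 * b 1 / b 0) : ℂ), 0; 1, 0, -(Real.sqrt (-b 2 / b 0) : ℂ)] (det_splitStdFrame_ne_zero b hb02 hb01) *
        Matrix.GeneralLinearGroup.mkOfDetNeZero (boostStd b c) (det_boostStd_ne_zero b c) *
        (Matrix.GeneralLinearGroup.mkOfDetNeZero
          !![(1 : ℂ), 0, (Real.sqrt (-b 2 / b 0) : ℂ); 0, (Real.sqrt (2 * b 1 / b 0) : ℂ), 0; 1, 0, -(Real.sqrt (-b 2 / b 0) : ℂ)] (det_splitStdFrame_ne_zero b hb02 hb01))⁻¹ :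
        GL (Fin 3) ℂ) : Matrix (Fin 3) (Fin 3) ℂ) = Matrix.diagonal (boostEig c)
    rw [Units.val_mul, Units.val_mul, Matrix.coe_units_inv, Matrix.GeneralLinearGroup.val_mkOfDetNeZero, Matrix.GeneralLinearGroup.val_mkOfDetNeZero,
      splitStdFrame_mul_boostStd b hb02 c, Matrix.mul_nonsing_inv_cancel_right (A := _) _ hNu]
  have h2 : ∀ c : Fin 3 → ℝ, glDiagonal 3 ℂ (fun i => Units.mk0 (boostEig c i) (boostEig_ne_zero c i)) =
      (((ι.trans (unitaryGroupOfFormCongr (starRingEnd ℂ) _ J))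
          ⟨Matrix.GeneralLinearGroup.mkOfDetNeZero (boostStd b c) (det_boostStd_ne_zero b c), boostStdGL_mem_unitaryGroupOfForm_diagonal b hb02 c⟩ :
            ↥(unitaryGroupOfForm (starRingEnd ℂ) J)) : GL (Fin 3) ℂ) := fun c => by
    apply Units.ext
    rw [coe_glDiagonal, h1 c]
    rfl
  refine ⟨ι.trans (unitaryGroupOfFormCongr (starRingEnd ℂ) _ J), h1, h2, fun c => (mem_torusU_iff _).2 ⟨_, h2 c⟩, fun h => rfl, ⟨_, fun h => rfl⟩⟩

end Standard

/-! ## §3 At a split-chart place of the house frame: `archLocal L 3 (diagonal α) w ≃ₜ* U(J₃)(ℂ)` -/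

section Place

variable (L : Type) [Field L] (α : Fin 3 → L) (w : {w : InfinitePlace L // IsComplex w})

/-- **The weight signs along the slots at a split-chart place of the house frame**: with `b = formRe α w ∘ lineOf (formSign α w)`, `b₀ b₂ < 0` (the boost plane is hyperbolic —
the definition of ★ `splitChartPlaces`) and `b₀ b₁ > 0` (slots `0, 1` carry the majority sign, ★ `sign_apply_lineOf`). [cite: Rogawski1990, §3.6 p. 31] -/
theorem formRe_lineOf_signs (hα : ∀ i, α i ≠ 0) (hsp : w ∈ splitChartPlaces L α) :
    (formRe L α w ∘ lineOf (formSign L α w)) 0 * (formRe L α w ∘ lineOf (formSign L α w)) 2 < 0 ∧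
      0 < (formRe L α w ∘ lineOf (formSign L α w)) 0 * (formRe L α w ∘ lineOf (formSign L α w)) 1 := by
  have hne : ∀ i, formSign L α w i ≠ 0 := fun i h => formRe_ne_zero hα hsp.1 i (sign_eq_zero_iff.1 h)
  have h02 : (formRe L α w ∘ lineOf (formSign L α w)) 0 * (formRe L α w ∘ lineOf (formSign L α w)) 2 < 0 := hsp.2
  refine ⟨h02, ?_⟩
  -- the signs are not all equal (else the plane `(τ 0, τ 2)` would be definite)
  have hind : ¬ (formSign L α w 0 = formSign L α w 1 ∧ formSign L α w 1 = formSign L α w 2) := by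
    rintro ⟨h01, h12⟩
    have hall : ∀ i j : Fin 3, formSign L α w i = formSign L α w j := by
      intro i j
      fin_cases i <;> fin_cases j <;> simp [h01, h12]
    have hsgn : SignType.sign ((formRe L α w ∘ lineOf (formSign L α w)) 0 * (formRe L α w ∘ lineOf (formSign L α w)) 2) = -1 := sign_neg h02
    rw [sign_mul] at hsgn
    have h0 := hne (lineOf (formSign L α w) 0)
    have hall' := hall (lineOf (formSign L α w) 2) (lineOf (formSign L α w) 0)
    change formSign L α w (lineOf (formSign L α w) 0) * formSign L α w (lineOf (formSign L α w) 2) = -1 at hsgn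
    rw [hall'] at hsgn
    revert h0 hsgn
    generalize formSign L α w (lineOf (formSign L α w) 0) = t
    revert t
    decide
  obtain ⟨h10, -⟩ := sign_apply_lineOf (hne 0) (hne 1) (hne 2) hind
  -- `sign b₁ = sign b₀ ≠ 0` ⇒ `b₀ b₁ > 0`
  have h0 := hne (lineOf (formSign L α w) 0)
  have hsgn : SignType.sign ((formRe L α w ∘ lineOf (formSign L α w)) 0 * (formRe L α w ∘ lineOf (formSign L α w)) 1) = 1 := by
    rw [sign_mul]
    change formSign L α w (lineOf (formSign L α w) 0) * formSign L α w (lineOf (formSign L α w) 1) = 1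
    rw [h10]
    revert h0
    generalize formSign L α w (lineOf (formSign L α w) 0) = t
    revert t
    decide
  exact sign_eq_one_iff.1 hsgn

/-- The local factor after relabelling, `G_w(α ∘ τ) = archLocal L 3 (diagonal (α ∘ τ)) w`, IS the standard-position group `U(diag b)(ℂ)`, `b = formRe α w ∘ τ` (as subgroups of `GL₃(ℂ)`;
★ `diagonal_map_embedding_eq_of_real`). [cite: Rogawski1990, §3.6 p. 31] -/
theorem archLocal_comp_lineOf_eq (hreal : ∀ i, (w.1.embedding (α i)).im = 0) :
    archLocal L 3 (Matrix.diagonal (α ∘ lineOf (formSign L α w))) w =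
      unitaryGroupOfForm (starRingEnd ℂ) (Matrix.diagonal fun i => (((formRe L α w ∘ lineOf (formSign L α w)) i : ℝ) : ℂ)) := by
  show unitaryGroupOfForm (starRingEnd ℂ) ((Matrix.diagonal (α ∘ lineOf (formSign L α w))).map w.1.embedding) = _
  rw [diagonal_map_embedding_eq_of_real (α := α ∘ lineOf (formSign L α w)) (fun i => hreal _)]
  rfl

/-- **(e3-5) THE FRAME BRIDGE AT A SPLIT-CHART PLACE.**  At a split-chart place `w` of the house frame (`α_i ≠ 0`, `σ_w α_i` real, boost plane hyperbolic) there is ONE FIXED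
topological-group isomorphism **`φ : archLocal L 3 (diagonal α) w ≃ₜ* U(J₃)(ℂ)`**, `hJ : J = (StdForm.antidiagonal 3).over ℂ` ((e3-1)∕(e3-3)'s variable VERBATIM), conjugation by
the fixed matrix `T = N_b · M(τ)⁻¹` (`τ = lineOf (formSign α w)`, `M(τ)` the permutation matrix of ★ `ArchLocalRelabelTransport`, `N_b` the Cayley-scale frame of §1–§2 at
`b = formRe α w ∘ τ`), which carries the split place chart to the DIAGONAL split Cartan ON THE NOSE: for every chart `S′ ∋ w` and coordinates `c`,
**`φ (gprimeBlock α w S′ c) = diag(boostEig (c w)) = diag(e^{x_w+iθ_w}, e^{iφ_w}, e^{−x_w+iθ_w})`** — as a matrix, as `glDiagonal 3 ℂ d` with the explicit unit triple, and as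
membership in ★ `torusU` ((e3-3)'s `hd`∕`ht`; regularity `(d 0)⁻¹ d 1 ≠ 1`, `(d 0)⁻¹ d 2 ≠ 1` for `x_w ≠ 0` is `boostEigUnits_regular_of_ne`).  Since `archPiEquivCM … (gprimeTorus α S′ c) w
= gprimeBlock α w S′ c` (★ `archPiEquivCM_gprimeTorus`), this is the `w`-component of the letter's chart torus read in E3's model.
[cite: PlatonovRapinchuk1994, §2.3] [cite: Rogawski1990, §1.9 p. 8; §3.6 p. 31] [cite: Knapp1986, Ch. V §3] -/
theorem exists_continuousMulEquiv_archLocal_splitChart_std (hα : ∀ i, α i ≠ 0) (hsp : w ∈ splitChartPlaces L α)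
    {J : Matrix (Fin 3) (Fin 3) ℂ} (hJ : J = (StdForm.antidiagonal 3).over ℂ) :
    ∃ φ : ↥(archLocal L 3 (Matrix.diagonal α) w) ≃ₜ* ↥(unitaryGroupOfForm (starRingEnd ℂ) J),
      (∀ (S' : Finset {w : InfinitePlace L // IsComplex w}) (c : {w : InfinitePlace L // IsComplex w} → Fin 3 → ℝ), w ∈ S' →
        (((φ (gprimeBlock L α w S' c) : ↥(unitaryGroupOfForm (starRingEnd ℂ) J)) : GL (Fin 3) ℂ) : Matrix (Fin 3) (Fin 3) ℂ) = Matrix.diagonal (boostEig (c w)) ∧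
        glDiagonal 3 ℂ (fun i => Units.mk0 (boostEig (c w) i) (boostEig_ne_zero (c w) i)) = ((φ (gprimeBlock L α w S' c) : ↥(unitaryGroupOfForm (starRingEnd ℂ) J)) : GL (Fin 3) ℂ) ∧
        φ (gprimeBlock L α w S' c) ∈ torusU (starRingEnd ℂ) J) ∧
      (∃ T : GL (Fin 3) ℂ, ∀ h : ↥(archLocal L 3 (Matrix.diagonal α) w),
        ((φ h : ↥(unitaryGroupOfForm (starRingEnd ℂ) J)) : GL (Fin 3) ℂ) = T * (h : GL (Fin 3) ℂ) * T⁻¹) := by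
  obtain ⟨hb02, hb01⟩ := formRe_lineOf_signs L α w hα hsp
  have hreal : ∀ i, (w.1.embedding (α i)).im = 0 := hsp.1
  have hU := archLocal_comp_lineOf_eq L α w hreal
  -- the relabelling isomorphism `e_τ : G_w(α ∘ τ) ≃ₜ* G_w(α)` (★ `ArchLocalRelabelTransport`) and the identity `G_w(α ∘ τ) = U(diag b)`
  set eτ : ↥(archLocal L 3 (Matrix.diagonal (α ∘ lineOf (formSign L α w))) w) ≃ₜ* ↥(archLocal L 3 (Matrix.diagonal α) w) :=
    ContinuousMulEquiv.restrictSubgroup (GLn.conjEquiv (Matrix.GeneralLinearGroup.mkOfDetNeZero _ (det_monomial_one_ne_zero 3 (lineOf (formSign L α w)))))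
      (archLocal L 3 (Matrix.diagonal (α ∘ lineOf (formSign L α w))) w) (archLocal L 3 (Matrix.diagonal α) w)
      (mem_archLocal_comp_perm_iff_conj_mem L 3 α w (lineOf (formSign L α w))) with heτ
  let ι : ↥(archLocal L 3 (Matrix.diagonal (α ∘ lineOf (formSign L α w))) w) ≃ₜ*
      ↥(unitaryGroupOfForm (starRingEnd ℂ) (Matrix.diagonal fun i => (((formRe L α w ∘ lineOf (formSign L α w)) i : ℝ) : ℂ))) :=
    { MulEquiv.subgroupCongr hU with
      continuous_toFun := continuous_induced_rng.2 continuous_subtype_val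
      continuous_invFun := continuous_induced_rng.2 continuous_subtype_val }
  obtain ⟨φ₀, h1, h2, -, -, T₀, hT₀⟩ := exists_continuousMulEquiv_diagonal_three_std (formRe L α w ∘ lineOf (formSign L α w)) hb02 hb01 hJ
  refine ⟨(eτ.symm.trans ι).trans φ₀, fun S' c hw => ?_, ?_⟩
  · -- the split place chart, pulled back through `e_τ`, is the standard boost
    have hmemB : Matrix.GeneralLinearGroup.mkOfDetNeZero (boostStd (formRe L α w ∘ lineOf (formSign L α w)) (c w)) (det_boostStd_ne_zero _ _) ∈
        archLocal L 3 (Matrix.diagonal (α ∘ lineOf (formSign L α w))) w := by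
      rw [hU]
      exact boostStdGL_mem_unitaryGroupOfForm_diagonal _ hb02 (c w)
    have hsymm : eτ.symm (gprimeBlock L α w S' c) = ⟨_, hmemB⟩ := by
      apply eτ.injective
      rw [ContinuousMulEquiv.apply_symm_apply]
      apply Subtype.ext
      rw [coe_gprimeBlock_of_mem L α c hw hsp, heτ, coe_relabel_apply]
      exact (conj_monomialGL_boostStd_eq_gprimeSplitGL (lineOf (formSign L α w)) (formRe L α w) (c w)).symm
    have hιB : ι (eτ.symm (gprimeBlock L α w S' c)) =
        ⟨Matrix.GeneralLinearGroup.mkOfDetNeZero (boostStd (formRe L α w ∘ lineOf (formSign L α w)) (c w)) (det_boostStd_ne_zero _ _),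
          boostStdGL_mem_unitaryGroupOfForm_diagonal _ hb02 (c w)⟩ := by
      rw [hsymm]
      rfl
    have hφ : ((eτ.symm.trans ι).trans φ₀) (gprimeBlock L α w S' c) =
        φ₀ ⟨Matrix.GeneralLinearGroup.mkOfDetNeZero (boostStd (formRe L α w ∘ lineOf (formSign L α w)) (c w)) (det_boostStd_ne_zero _ _),
          boostStdGL_mem_unitaryGroupOfForm_diagonal _ hb02 (c w)⟩ := by
      rw [ContinuousMulEquiv.trans_apply, ContinuousMulEquiv.trans_apply, hιB]
    rw [hφ]
    exact ⟨h1 (c w), h2 (c w), (mem_torusU_iff _).2 ⟨_, h2 (c w)⟩⟩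
  · -- the value clause: conjugation by `T₀ · M(τ)⁻¹`
    refine ⟨T₀ * (Matrix.GeneralLinearGroup.mkOfDetNeZero _ (det_monomial_one_ne_zero 3 (lineOf (formSign L α w))))⁻¹, fun h => ?_⟩
    rw [ContinuousMulEquiv.trans_apply, ContinuousMulEquiv.trans_apply, hT₀]
    show T₀ * ((Matrix.GeneralLinearGroup.mkOfDetNeZero _ (det_monomial_one_ne_zero 3 (lineOf (formSign L α w))))⁻¹ * (h : GL (Fin 3) ℂ) *
        Matrix.GeneralLinearGroup.mkOfDetNeZero _ (det_monomial_one_ne_zero 3 (lineOf (formSign L α w)))) * T₀⁻¹ = _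
    rw [_root_.mul_inv_rev, inv_inv]
    simp only [mul_assoc]

end Place

end Literature.NumberTheory.Automorphic.UnitaryGroup

end
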